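import Summits.Ventures.LatticeQCDFlow.Exactness.ReversibleOperatorL2
import HarnessLib

/-!
# A reversible sampler decorrelates no faster than linearly at its lag-one rate: `1 − ρ(n) ≤ n(1 − ρ(1))`, and the THINNED floor `τ_int^{(V)} ≥ 1/(V(1 − ρ(1))) − ½`

HONEST FRAMING: exact (Metropolis-corrected) sampling algorithms for lattice gauge theory;
figures of merit are autocorrelation/cost numbers at stated couplings and volumes; no
continuum-physics claim.  (SCALAR calibration rung S0-A: not a gauge result.)

Venture `LatticeQCDFlow` (cell pub-lqcd), topic `Exactness`; FANOUT row 2 (`s0-phi4`).  NEW WORK of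
the cell, composing `Exactness/ReversibleOperatorL2.lean` (pair positivity, iterates of a reversible
contraction are reversible contractions, the Madras–Slade floor `RevOp.tauInt_ge` on an admissible
class).  Nothing is cited as a fact.  The spectral-theorem one-liner this replaces
(`C(k) − C(k+1) = ∫ λᵏ(1 − λ) dσ_g ≤ ∫ (1 − λ) dσ_g` on `[−1, 1]`) is folklore; no printed statement
of the thinned floor was found (presearch: corpus `book:madras1993` §9.2, galaxy — none).

## Setting

As in `ReversibleOperatorL2`: weight `w ≥ 0`, admissible class `A` ((int) products `f h w`
integrable, (comb) `f + c h ∈ A`), operator `K` ((stab), (lin), (symm) `∫ (Kf) h w = ∫ f (Kh) w`,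
(contr) `∫ (Kf)² w ≤ ∫ f² w`); `a(n) = ∫ g (Kⁿ g) w` the autocovariances of `g ∈ A`.

## What is proved (namespace `RevOp`)

* `pair_test_nonneg` — pair positivity along the test observable `K u + c u`, in `a`-coordinates;
* `autocov_two_sub_three_le` — `a(2) − a(3) ≤ a(0) − a(1)` (`= ‖y‖² + ⟨y, K y⟩ ≥ 0`, `y = Ku − u`:
  the form `(1 − K)²(1 + K) ≥ 0` without functional calculus);
  `autocov_one_sub_two_le` — `a(1) − a(2) ≤ a(0) − a(1)` (`= ‖y‖² ≥ 0`);
* `autocov_even_step_le`, `autocov_even_decrement_le`, `autocov_odd_decrement_le`, and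
  **`autocov_decrement_le`** — `a(k) − a(k+1) ≤ a(0) − a(1)` for EVERY lag `k`;
  **`autocov_deficit_le`** — `a(0) − a(n) ≤ n (a(0) − a(1))`, i.e. **`one_sub_autocorr_le`**
  `1 − ρ(n) ≤ n (1 − ρ(1))`: a reversible sampler cannot decorrelate any observable in `n` steps
  by more than `n` times what it achieves in one step;
* **`thinned_tauInt_ge`** — observe the chain every `V ≥ 1` steps (one "sweep" of `V` elementary
  updates): the thinned sequence `n ↦ ρ(Vn)` is the autocorrelation of `g` under the reversible
  contraction `K^V`, so `RevOp.tauInt_ge` applies to it, and with `1 − ρ(V) ≤ V(1 − ρ(1))`: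
  `τ_int^{(V)} = ½ + Σ_{n≥1} ρ(Vn) ≥ (1 + ρ(V))/(2(1 − ρ(V))) ≥ 1/(V(1 − ρ(1))) − ½`.

Reading (no numerics implied): a measured lag-one autocorrelation `ρ̂(1)` per ELEMENTARY update
(one site hit, one flow proposal) bounds the sweep-level cost: in units of `V` updates,
`τ_int ≥ 1/(V(1 − ρ(1))) − ½`.  This is the composition step of the critical-slowing-down floor of
`Exactness/ReversibleLocalityFloor.lean`.  NOT CLAIMED: `ρ(V) < 1` / summability for any run
(hypotheses); ordered (non-reversible) sweeps; any sign for `a(k) − a(k+1)` itself.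
-/

namespace Summit.Ventures.LatticeQCDFlow.Exactness

open Real MeasureTheory Filter Finset
open Summit.Ventures.LatticeQCDFlow.Scoring

namespace RevOp

variable {X : Type*} [MeasurableSpace X] {μ : Measure X} {w : X → ℝ} {A : (X → ℝ) → Prop}
  {K : (X → ℝ) → (X → ℝ)}

/-- Pair positivity along the test observable `K u + c u`, written in the autocovariances
`a(n) = ∫ u (Kⁿ u) w` of `u`:
`0 ≤ [a(2m+2) + 2c a(2m+1) + c² a(2m)] + [a(2m+3) + 2c a(2m+2) + c² a(2m+1)]`. -/
theorem pair_test_nonneg (hw0 : ∀ x, 0 ≤ w x)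
    (hAi : ∀ ⦃f h : X → ℝ⦄, A f → A h → Integrable (fun x => f x * h x * w x) μ)
    (hAc : ∀ ⦃f h : X → ℝ⦄ (c : ℝ), A f → A h → A (fun x => f x + c * h x))
    (hAK : ∀ ⦃f : X → ℝ⦄, A f → A (K f))
    (hlin : ∀ ⦃f h : X → ℝ⦄ (c : ℝ), A f → A h →
      ∀ x, K (fun s => f s + c * h s) x = K f x + c * K h x)
    (hsymm : ∀ ⦃f h : X → ℝ⦄, A f → A h →
      ∫ x, K f x * h x * w x ∂μ = ∫ x, f x * K h x * w x ∂μ)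
    (hcontr : ∀ ⦃f : X → ℝ⦄, A f → ∫ x, K f x ^ 2 * w x ∂μ ≤ ∫ x, f x ^ 2 * w x ∂μ)
    {u : X → ℝ} (hu : A u) (c : ℝ) (m : ℕ) :
    0 ≤ ((∫ x, u x * (K^[2 * m + 2] u) x * w x ∂μ) + 2 * c * (∫ x, u x * (K^[2 * m + 1] u) x * w x ∂μ)
          + c ^ 2 * ∫ x, u x * (K^[2 * m] u) x * w x ∂μ)
        + ((∫ x, u x * (K^[2 * m + 1 + 2] u) x * w x ∂μ)
          + 2 * c * (∫ x, u x * (K^[2 * m + 1 + 1] u) x * w x ∂μ)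
          + c ^ 2 * ∫ x, u x * (K^[2 * m + 1] u) x * w x ∂μ) := by
  have hy : A (fun s => K u s + c * u s) := hAc c (hAK hu) hu
  have hp := pair_nonneg hw0 hAi hAK hsymm hcontr hy m
  beta_reduce at hp
  rwa [autocov_test_observable hAi hAK hlin hsymm hu c (2 * m),
    autocov_test_observable hAi hAK hlin hsymm hu c (2 * m + 1)] at hp

/-- `a(2) − a(3) ≤ a(0) − a(1)`: the form `(1 − K)²(1 + K)` is nonnegative
(`= ‖y‖² + ⟨y, K y⟩` with `y = K u − u`, pair positivity at `m = 0`). -/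
theorem autocov_two_sub_three_le (hw0 : ∀ x, 0 ≤ w x)
    (hAi : ∀ ⦃f h : X → ℝ⦄, A f → A h → Integrable (fun x => f x * h x * w x) μ)
    (hAc : ∀ ⦃f h : X → ℝ⦄ (c : ℝ), A f → A h → A (fun x => f x + c * h x))
    (hAK : ∀ ⦃f : X → ℝ⦄, A f → A (K f))
    (hlin : ∀ ⦃f h : X → ℝ⦄ (c : ℝ), A f → A h →
      ∀ x, K (fun s => f s + c * h s) x = K f x + c * K h x)
    (hsymm : ∀ ⦃f h : X → ℝ⦄, A f → A h →
      ∫ x, K f x * h x * w x ∂μ = ∫ x, f x * K h x * w x ∂μ)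
    (hcontr : ∀ ⦃f : X → ℝ⦄, A f → ∫ x, K f x ^ 2 * w x ∂μ ≤ ∫ x, f x ^ 2 * w x ∂μ)
    {u : X → ℝ} (hu : A u) :
    (∫ x, u x * (K^[2] u) x * w x ∂μ) - ∫ x, u x * (K^[3] u) x * w x ∂μ
      ≤ (∫ x, u x * (K^[0] u) x * w x ∂μ) - ∫ x, u x * (K^[1] u) x * w x ∂μ := by
  have hp := pair_test_nonneg hw0 hAi hAc hAK hlin hsymm hcontr hu (-1) 0
  norm_num at hp ⊢
  linarith

/-- `a(1) − a(2) ≤ a(0) − a(1)`: `‖K u − u‖² = a(0) − 2a(1) + a(2) ≥ 0`. -/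
theorem autocov_one_sub_two_le (hw0 : ∀ x, 0 ≤ w x)
    (hAi : ∀ ⦃f h : X → ℝ⦄, A f → A h → Integrable (fun x => f x * h x * w x) μ)
    (hAK : ∀ ⦃f : X → ℝ⦄, A f → A (K f))
    (hlin : ∀ ⦃f h : X → ℝ⦄ (c : ℝ), A f → A h →
      ∀ x, K (fun s => f s + c * h s) x = K f x + c * K h x)
    (hsymm : ∀ ⦃f h : X → ℝ⦄, A f → A h →
      ∫ x, K f x * h x * w x ∂μ = ∫ x, f x * K h x * w x ∂μ)
    {u : X → ℝ} (hu : A u) :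
    (∫ x, u x * (K^[1] u) x * w x ∂μ) - ∫ x, u x * (K^[2] u) x * w x ∂μ
      ≤ (∫ x, u x * (K^[0] u) x * w x ∂μ) - ∫ x, u x * (K^[1] u) x * w x ∂μ := by
  have h0 : 0 ≤ ∫ x, (K u x + (-1) * u x) * (K^[0] (fun s => K u s + (-1) * u s)) x * w x ∂μ :=
    integral_nonneg fun x => by
      simp only [Function.iterate_zero, id_eq]
      exact mul_nonneg (mul_self_nonneg _) (hw0 x)
  rw [autocov_test_observable hAi hAK hlin hsymm hu (-1) 0] at h0
  norm_num at h0 ⊢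
  linarith

/-- The even-lag decrements do not increase: `a(2m+2) − a(2m+3) ≤ a(2m) − a(2m+1)`
(`autocov_two_sub_three_le` for `Kᵐ u`, transported by the two-time form). -/
theorem autocov_even_step_le (hw0 : ∀ x, 0 ≤ w x)
    (hAi : ∀ ⦃f h : X → ℝ⦄, A f → A h → Integrable (fun x => f x * h x * w x) μ)
    (hAc : ∀ ⦃f h : X → ℝ⦄ (c : ℝ), A f → A h → A (fun x => f x + c * h x))
    (hAK : ∀ ⦃f : X → ℝ⦄, A f → A (K f))
    (hlin : ∀ ⦃f h : X → ℝ⦄ (c : ℝ), A f → A h →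
      ∀ x, K (fun s => f s + c * h s) x = K f x + c * K h x)
    (hsymm : ∀ ⦃f h : X → ℝ⦄, A f → A h →
      ∫ x, K f x * h x * w x ∂μ = ∫ x, f x * K h x * w x ∂μ)
    (hcontr : ∀ ⦃f : X → ℝ⦄, A f → ∫ x, K f x ^ 2 * w x ∂μ ≤ ∫ x, f x ^ 2 * w x ∂μ)
    {u : X → ℝ} (hu : A u) (m : ℕ) :
    (∫ x, u x * (K^[2 * m + 2] u) x * w x ∂μ) - ∫ x, u x * (K^[2 * m + 3] u) x * w x ∂μ
      ≤ (∫ x, u x * (K^[2 * m] u) x * w x ∂μ) - ∫ x, u x * (K^[2 * m + 1] u) x * w x ∂μ := by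
  have hum := iterate_mem hAK m hu
  have h := autocov_two_sub_three_le hw0 hAi hAc hAK hlin hsymm hcontr hum
  have e : ∀ j, ∫ x, (K^[m] u) x * (K^[j] (K^[m] u)) x * w x ∂μ
      = ∫ x, u x * (K^[2 * m + j] u) x * w x ∂μ := by
    intro j
    have h2 := two_time hAK hsymm hu m (j + m)
    simp only [← Function.iterate_add_apply] at h2 ⊢
    rw [h2, show m + (j + m) = 2 * m + j by ring]
  rw [e 2, e 3, e 0, e 1] at h
  simpa only [Nat.add_zero] using h

/-- Every even-lag decrement is at most the first one: `a(2m) − a(2m+1) ≤ a(0) − a(1)`. -/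
theorem autocov_even_decrement_le (hw0 : ∀ x, 0 ≤ w x)
    (hAi : ∀ ⦃f h : X → ℝ⦄, A f → A h → Integrable (fun x => f x * h x * w x) μ)
    (hAc : ∀ ⦃f h : X → ℝ⦄ (c : ℝ), A f → A h → A (fun x => f x + c * h x))
    (hAK : ∀ ⦃f : X → ℝ⦄, A f → A (K f))
    (hlin : ∀ ⦃f h : X → ℝ⦄ (c : ℝ), A f → A h →
      ∀ x, K (fun s => f s + c * h s) x = K f x + c * K h x)
    (hsymm : ∀ ⦃f h : X → ℝ⦄, A f → A h →
      ∫ x, K f x * h x * w x ∂μ = ∫ x, f x * K h x * w x ∂μ)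
    (hcontr : ∀ ⦃f : X → ℝ⦄, A f → ∫ x, K f x ^ 2 * w x ∂μ ≤ ∫ x, f x ^ 2 * w x ∂μ)
    {u : X → ℝ} (hu : A u) :
    ∀ m : ℕ, (∫ x, u x * (K^[2 * m] u) x * w x ∂μ) - ∫ x, u x * (K^[2 * m + 1] u) x * w x ∂μ
      ≤ (∫ x, u x * (K^[0] u) x * w x ∂μ) - ∫ x, u x * (K^[1] u) x * w x ∂μ
  | 0 => by simp
  | m + 1 => by
    have h1 := autocov_even_decrement_le hw0 hAi hAc hAK hlin hsymm hcontr hu m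
    have h2 := autocov_even_step_le hw0 hAi hAc hAK hlin hsymm hcontr hu m
    rw [show 2 * (m + 1) = 2 * m + 2 by ring, show 2 * m + 2 + 1 = 2 * m + 3 by ring]
    linarith

/-- Odd-lag decrements are at most the preceding even one:
`a(2m+1) − a(2m+2) ≤ a(2m) − a(2m+1)` (`autocov_one_sub_two_le` for `Kᵐ u`). -/
theorem autocov_odd_decrement_le (hw0 : ∀ x, 0 ≤ w x)
    (hAi : ∀ ⦃f h : X → ℝ⦄, A f → A h → Integrable (fun x => f x * h x * w x) μ)
    (hAK : ∀ ⦃f : X → ℝ⦄, A f → A (K f))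
    (hlin : ∀ ⦃f h : X → ℝ⦄ (c : ℝ), A f → A h →
      ∀ x, K (fun s => f s + c * h s) x = K f x + c * K h x)
    (hsymm : ∀ ⦃f h : X → ℝ⦄, A f → A h →
      ∫ x, K f x * h x * w x ∂μ = ∫ x, f x * K h x * w x ∂μ)
    {u : X → ℝ} (hu : A u) (m : ℕ) :
    (∫ x, u x * (K^[2 * m + 1] u) x * w x ∂μ) - ∫ x, u x * (K^[2 * m + 2] u) x * w x ∂μ
      ≤ (∫ x, u x * (K^[2 * m] u) x * w x ∂μ) - ∫ x, u x * (K^[2 * m + 1] u) x * w x ∂μ := by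
  have hum := iterate_mem hAK m hu
  have h := autocov_one_sub_two_le hw0 hAi hAK hlin hsymm hum
  have e : ∀ j, ∫ x, (K^[m] u) x * (K^[j] (K^[m] u)) x * w x ∂μ
      = ∫ x, u x * (K^[2 * m + j] u) x * w x ∂μ := by
    intro j
    have h2 := two_time hAK hsymm hu m (j + m)
    simp only [← Function.iterate_add_apply] at h2 ⊢
    rw [h2, show m + (j + m) = 2 * m + j by ring]
  rw [e 1, e 2, e 0] at h
  simpa only [Nat.add_zero] using h

/-- **EVERY lag decrement is at most the first one**: `a(k) − a(k+1) ≤ a(0) − a(1)` for a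
reversible contraction and any admissible `u` (spectrally: `λᵏ(1 − λ) ≤ 1 − λ` on `[−1, 1]`). -/
theorem autocov_decrement_le (hw0 : ∀ x, 0 ≤ w x)
    (hAi : ∀ ⦃f h : X → ℝ⦄, A f → A h → Integrable (fun x => f x * h x * w x) μ)
    (hAc : ∀ ⦃f h : X → ℝ⦄ (c : ℝ), A f → A h → A (fun x => f x + c * h x))
    (hAK : ∀ ⦃f : X → ℝ⦄, A f → A (K f))
    (hlin : ∀ ⦃f h : X → ℝ⦄ (c : ℝ), A f → A h →
      ∀ x, K (fun s => f s + c * h s) x = K f x + c * K h x)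
    (hsymm : ∀ ⦃f h : X → ℝ⦄, A f → A h →
      ∫ x, K f x * h x * w x ∂μ = ∫ x, f x * K h x * w x ∂μ)
    (hcontr : ∀ ⦃f : X → ℝ⦄, A f → ∫ x, K f x ^ 2 * w x ∂μ ≤ ∫ x, f x ^ 2 * w x ∂μ)
    {u : X → ℝ} (hu : A u) (k : ℕ) :
    (∫ x, u x * (K^[k] u) x * w x ∂μ) - ∫ x, u x * (K^[k + 1] u) x * w x ∂μ
      ≤ (∫ x, u x ^ 2 * w x ∂μ) - ∫ x, u x * K u x * w x ∂μ := by
  have e0 : (∫ x, u x ^ 2 * w x ∂μ) - ∫ x, u x * K u x * w x ∂μ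
      = (∫ x, u x * (K^[0] u) x * w x ∂μ) - ∫ x, u x * (K^[1] u) x * w x ∂μ := by
    simp only [Function.iterate_zero, id_eq, Function.iterate_one, sq]
  rw [e0]
  obtain ⟨m, rfl | rfl⟩ := Nat.even_or_odd' k
  · exact autocov_even_decrement_le hw0 hAi hAc hAK hlin hsymm hcontr hu m
  · exact (autocov_odd_decrement_le hw0 hAi hAK hlin hsymm hu m).trans
      (autocov_even_decrement_le hw0 hAi hAc hAK hlin hsymm hcontr hu m)

/-- **The deficit grows at most linearly**: `a(0) − a(n) ≤ n (a(0) − a(1))` — in `n` steps a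
reversible sampler decorrelates an observable by at most `n` times its one-step decorrelation. -/
theorem autocov_deficit_le (hw0 : ∀ x, 0 ≤ w x)
    (hAi : ∀ ⦃f h : X → ℝ⦄, A f → A h → Integrable (fun x => f x * h x * w x) μ)
    (hAc : ∀ ⦃f h : X → ℝ⦄ (c : ℝ), A f → A h → A (fun x => f x + c * h x))
    (hAK : ∀ ⦃f : X → ℝ⦄, A f → A (K f))
    (hlin : ∀ ⦃f h : X → ℝ⦄ (c : ℝ), A f → A h →
      ∀ x, K (fun s => f s + c * h s) x = K f x + c * K h x)
    (hsymm : ∀ ⦃f h : X → ℝ⦄, A f → A h →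
      ∫ x, K f x * h x * w x ∂μ = ∫ x, f x * K h x * w x ∂μ)
    (hcontr : ∀ ⦃f : X → ℝ⦄, A f → ∫ x, K f x ^ 2 * w x ∂μ ≤ ∫ x, f x ^ 2 * w x ∂μ)
    {u : X → ℝ} (hu : A u) :
    ∀ n : ℕ, (∫ x, u x ^ 2 * w x ∂μ) - ∫ x, u x * (K^[n] u) x * w x ∂μ
      ≤ n * ((∫ x, u x ^ 2 * w x ∂μ) - ∫ x, u x * K u x * w x ∂μ)
  | 0 => by simp [sq]
  | n + 1 => by
    have h1 := autocov_deficit_le hw0 hAi hAc hAK hlin hsymm hcontr hu n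
    have h2 := autocov_decrement_le hw0 hAi hAc hAK hlin hsymm hcontr hu n
    push_cast
    linarith

/-- **Normalised form**: `1 − ρ(n) ≤ n (1 − ρ(1))` for the autocorrelation `ρ(n) = a(n)/a(0)` of
any admissible observable with `a(0) = ∫ u² w > 0` under a reversible contraction. -/
theorem one_sub_autocorr_le (hw0 : ∀ x, 0 ≤ w x)
    (hAi : ∀ ⦃f h : X → ℝ⦄, A f → A h → Integrable (fun x => f x * h x * w x) μ)
    (hAc : ∀ ⦃f h : X → ℝ⦄ (c : ℝ), A f → A h → A (fun x => f x + c * h x))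
    (hAK : ∀ ⦃f : X → ℝ⦄, A f → A (K f))
    (hlin : ∀ ⦃f h : X → ℝ⦄ (c : ℝ), A f → A h →
      ∀ x, K (fun s => f s + c * h s) x = K f x + c * K h x)
    (hsymm : ∀ ⦃f h : X → ℝ⦄, A f → A h →
      ∫ x, K f x * h x * w x ∂μ = ∫ x, f x * K h x * w x ∂μ)
    (hcontr : ∀ ⦃f : X → ℝ⦄, A f → ∫ x, K f x ^ 2 * w x ∂μ ≤ ∫ x, f x ^ 2 * w x ∂μ)
    {u : X → ℝ} (hu : A u) (hP : 0 < ∫ x, u x ^ 2 * w x ∂μ) (n : ℕ) :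
    1 - (∫ x, u x * (K^[n] u) x * w x ∂μ) / (∫ x, u x ^ 2 * w x ∂μ)
      ≤ n * (1 - (∫ x, u x * K u x * w x ∂μ) / ∫ x, u x ^ 2 * w x ∂μ) := by
  have h := autocov_deficit_le hw0 hAi hAc hAK hlin hsymm hcontr hu n
  have e1 : 1 - (∫ x, u x * (K^[n] u) x * w x ∂μ) / (∫ x, u x ^ 2 * w x ∂μ)
      = ((∫ x, u x ^ 2 * w x ∂μ) - ∫ x, u x * (K^[n] u) x * w x ∂μ) / ∫ x, u x ^ 2 * w x ∂μ := by
    field_simp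
  have e2 : (n : ℝ) * (1 - (∫ x, u x * K u x * w x ∂μ) / ∫ x, u x ^ 2 * w x ∂μ)
      = (n * ((∫ x, u x ^ 2 * w x ∂μ) - ∫ x, u x * K u x * w x ∂μ)) / ∫ x, u x ^ 2 * w x ∂μ := by
    field_simp
  rw [e1, e2]
  exact div_le_div_of_nonneg_right h hP.le

/-- The real-variable step of the thinned floor: from `1 − ρ(V) ≤ V(1 − ρ(1))` (both `ρ < 1`,
`V ≥ 1`) to `1/(V(1 − ρ(1))) − ½ ≤ (1 + ρ(V))/(2(1 − ρ(V)))` (`= 1/(1 − ρ(V)) − ½`). -/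
theorem floor_transfer {r1 rV V : ℝ} (hρV : rV < 1) (h : 1 - rV ≤ V * (1 - r1)) :
    1 / (V * (1 - r1)) - 1 / 2 ≤ (1 + rV) / (2 * (1 - rV)) := by
  have hx0 : 0 < 1 - rV := by linarith
  have hxne : (1 - rV) ≠ 0 := hx0.ne'
  have e : (1 + rV) / (2 * (1 - rV)) = 1 / (1 - rV) - 1 / 2 := by
    field_simp
    ring
  rw [e]
  have := one_div_le_one_div_of_le hx0 h
  linarith

/-- **THE THINNED FLOOR.**  Observe a reversible sampler every `V ≥ 1` elementary steps.  The
thinned autocorrelation `n ↦ ρ(Vn)` of an admissible `g` is the autocorrelation of `g` under the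
reversible contraction `K^V`, so (Madras–Slade on the class) `τ_int^{(V)} ≥ (1 + ρ(V))/(2(1 − ρ(V)))`,
and since `1 − ρ(V) ≤ V(1 − ρ(1))`:  `τ_int^{(V)} = ½ + Σ_{n≥1} ρ(Vn) ≥ 1/(V(1 − ρ(1))) − ½`.
Hypotheses: the thinned series is summable and `ρ(V) < 1`. -/
theorem thinned_tauInt_ge (hw0 : ∀ x, 0 ≤ w x)
    (hAi : ∀ ⦃f h : X → ℝ⦄, A f → A h → Integrable (fun x => f x * h x * w x) μ)
    (hAc : ∀ ⦃f h : X → ℝ⦄ (c : ℝ), A f → A h → A (fun x => f x + c * h x))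
    (hAK : ∀ ⦃f : X → ℝ⦄, A f → A (K f))
    (hlin : ∀ ⦃f h : X → ℝ⦄ (c : ℝ), A f → A h →
      ∀ x, K (fun s => f s + c * h s) x = K f x + c * K h x)
    (hsymm : ∀ ⦃f h : X → ℝ⦄, A f → A h →
      ∫ x, K f x * h x * w x ∂μ = ∫ x, f x * K h x * w x ∂μ)
    (hcontr : ∀ ⦃f : X → ℝ⦄, A f → ∫ x, K f x ^ 2 * w x ∂μ ≤ ∫ x, f x ^ 2 * w x ∂μ)
    {g : X → ℝ} (hg : A g) {V : ℕ} (hV : 0 < V)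
    (hs : Summable fun n => (∫ x, g x * (K^[V * (n + 1)] g) x * w x ∂μ) / ∫ x, g x ^ 2 * w x ∂μ)
    (hρV : (∫ x, g x * (K^[V] g) x * w x ∂μ) / (∫ x, g x ^ 2 * w x ∂μ) < 1) :
    1 / (V * (1 - (∫ x, g x * K g x * w x ∂μ) / ∫ x, g x ^ 2 * w x ∂μ)) - 1 / 2
      ≤ tauInt (fun n => (∫ x, g x * (K^[V * n] g) x * w x ∂μ) / ∫ x, g x ^ 2 * w x ∂μ) := by
  -- the thinned operator `K^V` is again a reversible contraction on the class
  have hAK' : ∀ ⦃f : X → ℝ⦄, A f → A (K^[V] f) := fun f hf => iterate_mem hAK V hf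
  have hlin' : ∀ ⦃f h : X → ℝ⦄ (c : ℝ), A f → A h →
      ∀ x, K^[V] (fun s => f s + c * h s) x = (K^[V] f) x + c * (K^[V] h) x :=
    fun f h c hf hh => iterate_add_mul hAK hlin c V hf hh
  have hsymm' : ∀ ⦃f h : X → ℝ⦄, A f → A h →
      ∫ x, (K^[V] f) x * h x * w x ∂μ = ∫ x, f x * (K^[V] h) x * w x ∂μ :=
    fun f h hf hh => iterate_symm hAK hsymm V hf hh
  have hcontr' : ∀ ⦃f : X → ℝ⦄, A f → ∫ x, (K^[V] f) x ^ 2 * w x ∂μ ≤ ∫ x, f x ^ 2 * w x ∂μ :=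
    fun f hf => iterate_contr hAK hcontr V hf
  have hs' : Summable fun n =>
      (∫ x, g x * ((K^[V])^[n + 1] g) x * w x ∂μ) / ∫ x, g x ^ 2 * w x ∂μ := by
    simpa only [← Function.iterate_mul] using hs
  have hfloor := tauInt_ge (K := K^[V]) hw0 hAi hAc hAK' hlin' hsymm' hcontr' hg hs' hρV
  simp only [← Function.iterate_mul] at hfloor
  refine le_trans (floor_transfer hρV ?_) hfloor
  -- `1 − ρ(V) ≤ V (1 − ρ(1))`
  rcases eq_or_lt_of_le (integral_nonneg fun x => mul_nonneg (sq_nonneg (g x)) (hw0 x) :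
      (0 : ℝ) ≤ ∫ x, g x ^ 2 * w x ∂μ) with hz | hPpos
  · rw [← hz]
    simp only [div_zero, sub_zero, mul_one]
    exact_mod_cast hV
  · exact one_sub_autocorr_le hw0 hAi hAc hAK hlin hsymm hcontr hg hPpos V

end RevOp

end Summit.Ventures.LatticeQCDFlow.Exactness
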